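import Literature.AlgebraicGeometry.Resolution.CobordantBlowupAlgebra
import Mathlib.Data.Finsupp.Weight
import Mathlib.Algebra.MonoidAlgebra.MapDomain
import Mathlib.RingTheory.Localization.Ideal
import HarnessLib

/-!
# Cobordant blow-ups (Włodarczyk 2022), IV: extended Rees algebras of filtrations;
# `𝒪_B = ⊕ₙ 𝒥ₙ tⁿ`

Topic: `Literature/AlgebraicGeometry/Resolution`. Continuation of `CobordantBlowupAlgebra.lean`
(definition request `defn-CobordantBlowup`). Włodarczyk, *Functorial resolution by torus
actions*, arXiv:2203.03090:

* §2.2 "Rational Rees algebras" (integral gradings) and App. §5.1, Def. 5.1.1 ("Cobordant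
  blow-ups of Rees algebras"): for a Rees algebra `R = ⊕_{a ≥ 0} R_a t^a ⊆ 𝒪_X[t]` on a scheme
  `X` (`R₀ = 𝒪_X`, `R_a · R_b ⊆ R_{a+b}`), the **full cobordant blow-up of `R`** is
  `B := Spec_X (R[t⁻¹])`, `R[t⁻¹] = 𝒪_X[t⁻¹] ⊕ ⊕_{a > 0} R_a t^a ⊆ 𝒪_X[t, t⁻¹]` the extended Rees
  algebra;
* Lemma 2.1.8 / §2.2.7 ("Regular centers vs. Rees centers"): for the weighted centre
  `𝒥 = (u₁^{1/w₁}, …, u_k^{1/w_k})` the Rees algebra is `𝒜_𝒥 = ⊕_a 𝒥_a t^a` with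
  `𝒥_a = (u^α : Σ αᵢ wᵢ ≥ a)` (Lemma 2.1.9: `(𝒥^a)_X = (u^α | Σ αᵢ wᵢ ≥ a)`), and the extended
  Rees algebra is `𝒜_𝒥^ext = 𝒪_X[t⁻¹, u₁ t^{w₁}, …, u_k t^{w_k}]`.

This file is the ring-level dictionary between the two descriptions — the bridge between the
affine model `Spec (cobordantAlgebra u w)` and the global cobordant blow-up `Spec_Y ⊕ₙ 𝒥ₙ tⁿ` of
a weighted centre on a general scheme (which restricts to the affine model over the affine
opens on which the centre is presented by `(u, w)`):

* `IdealFiltration A` — a descending multiplicative filtration `A = J₀ ⊇ J₁ ⊇ ⋯`,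
  `J_m J_n ⊆ J_{m+n}` (the graded pieces of a Rees algebra with integral grading);
  `IdealFiltration.extendedRees F ⊆ A[t, t⁻¹]` — **the extended Rees algebra `R[t⁻¹]`**
  (Laurent polynomials whose coefficient of `tⁿ`, `n ≥ 0`, lies in `Jₙ`), with
  `mem_extendedRees_iff`, `T_neg_one_mem_extendedRees`, `C_mul_T_mem_extendedRees_iff`;
* `weightedFiltration u w` — the filtration `𝒥ₙ = (u^α : Σ αᵢ wᵢ ≥ n)` of a weighted centre;
* `cobordantAlgebra_eq_extendedRees` — **`A[t⁻¹, uᵢ t^{wᵢ}] = ⊕ₙ 𝒥ₙ tⁿ`**: the algebra of the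
  full cobordant blow-up of Def. 2.3.5 is the extended Rees algebra of the weighted filtration
  (Lemma 2.1.8: `𝒜_𝒥 = ⊕ I_{ν,a} t^a`; §2.2.7).

## Sources

* J. Włodarczyk, arXiv:2203.03090 (July 2025 version): §2.1.7–2.1.9 (Lemmas 2.1.8, 2.1.9),
  §2.2 and §2.2.7, Def. 2.3.5, App. §5.1 Def. 5.1.1 (PDF pp. 7–10, 46). [Wlodarczyk2022]
-/

noncomputable section

open scoped LaurentPolynomial
open LaurentPolynomial

namespace Literature.AlgebraicGeometry.Resolution

universe u v

variable {A : Type u} [CommRing A]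

/-- A **descending multiplicative filtration of ideals** `A = J₀ ⊇ J₁ ⊇ J₂ ⊇ ⋯` with
`J_m · J_n ⊆ J_{m+n}`: the graded pieces of a Rees algebra `⊕ₙ Jₙ tⁿ ⊆ A[t]` with integral
grading (Włodarczyk, §2.2: "`R = ⊕ R_a t^a ⊂ 𝒪_X[t^{1/w_R}]`, `R₀ = 𝒪_X`, `R_a · R_b ⊆ R_{a+b}`";
we also require the pieces to decrease, as for the Rees algebras `𝒜_𝒥 = ⊕ (𝒥^a)_X t^a` of
`ℚ`-ideals, ibid. §2.1.3 — this is what makes `R[t⁻¹]` closed under multiplication by `t⁻¹`).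
[cite: Wlodarczyk2022, §2.2] -/
structure IdealFiltration (A : Type u) [CommRing A] where
  /-- the `n`-th piece `Jₙ` -/
  ideal : ℕ → Ideal A
  /-- `J₀ = A` -/
  ideal_zero : ideal 0 = ⊤
  /-- `J₀ ⊇ J₁ ⊇ ⋯` -/
  antitone : Antitone ideal
  /-- `J_m J_n ⊆ J_{m+n}` -/
  mul_le : ∀ m n, ideal m * ideal n ≤ ideal (m + n)

namespace IdealFiltration

variable (F : IdealFiltration A)

/-- The coefficient condition defining the extended Rees algebra: an element placed in degree
`m ∈ ℤ` must lie in `Jₘ` when `m ≥ 0` (no condition for `m < 0`). [folklore] -/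
def CoeffMem (m : ℤ) (a : A) : Prop := ∀ n : ℕ, (n : ℤ) = m → a ∈ F.ideal n

variable {F}

/-- For `m < 0` the coefficient condition is empty. [folklore] -/
theorem coeffMem_of_neg {m : ℤ} (hm : m < 0) (a : A) : F.CoeffMem m a :=
  fun _ hn => absurd hm (by omega)

/-- In degree `n ≥ 0` the coefficient condition is `a ∈ Jₙ`. [folklore] -/
theorem coeffMem_natCast_iff {n : ℕ} {a : A} : F.CoeffMem (n : ℤ) a ↔ a ∈ F.ideal n :=
  ⟨fun h => h n rfl, fun h k hk => by rwa [show k = n by exact_mod_cast hk]⟩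

/-- `0` satisfies every coefficient condition. [folklore] -/
theorem coeffMem_zero (m : ℤ) : F.CoeffMem m 0 := fun _ _ => Ideal.zero_mem _

/-- The coefficient conditions are closed under `+`. [folklore] -/
theorem CoeffMem.add {m : ℤ} {a b : A} (ha : F.CoeffMem m a) (hb : F.CoeffMem m b) :
    F.CoeffMem m (a + b) :=
  fun n hn => Ideal.add_mem _ (ha n hn) (hb n hn)

/-- The coefficient conditions are closed under scalars. [folklore] -/
theorem CoeffMem.mul_left {m : ℤ} {a : A} (c : A) (ha : F.CoeffMem m a) : F.CoeffMem m (c * a) :=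
  fun n hn => Ideal.mul_mem_left _ c (ha n hn)

/-- **Multiplicativity of the coefficient conditions** (`J_m J_n ⊆ J_{m+n}`, and the antitone
property for mixed signs). [folklore] -/
theorem CoeffMem.mul {m₁ m₂ : ℤ} {a b : A} (ha : F.CoeffMem m₁ a) (hb : F.CoeffMem m₂ b) :
    F.CoeffMem (m₁ + m₂) (a * b) := by
  intro n hn
  rcases lt_or_ge m₁ 0 with h₁ | h₁
  · -- `m₁ < 0`, so `m₂ = n - m₁ > n ≥ 0`
    have hb' : b ∈ F.ideal (n - m₁).toNat := hb _ (by omega)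
    exact Ideal.mul_mem_left _ a (F.antitone (by omega) hb')
  rcases lt_or_ge m₂ 0 with h₂ | h₂
  · have ha' : a ∈ F.ideal (n - m₂).toNat := ha _ (by omega)
    exact Ideal.mul_mem_right b _ (F.antitone (by omega) ha')
  · have ha' : a ∈ F.ideal m₁.toNat := ha _ (by omega)
    have hb' : b ∈ F.ideal m₂.toNat := hb _ (by omega)
    have h := F.mul_le _ _ (Ideal.mul_mem_mul ha' hb')
    rwa [show m₁.toNat + m₂.toNat = n by omega] at h

variable (F)

/-- **The extended Rees algebra `R[t⁻¹] = A[t⁻¹] ⊕ ⊕_{n ≥ 1} Jₙ tⁿ ⊆ A[t, t⁻¹]`** of the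
filtration `(Jₙ)`: the Laurent polynomials whose coefficient of `tⁿ` lies in `Jₙ` for every
`n ≥ 0`. Its relative spectrum is the full cobordant blow-up of the Rees algebra `R = ⊕ Jₙ tⁿ`
(Włodarczyk, App. Def. 5.1.1: "`B := Spec_X (R[t⁻¹]) → X`"; §2.2: "the extended Rees algebra is
`R^ext := R[t^{-1/w}]`"). [cite: Wlodarczyk2022, Def. 5.1.1] -/
def extendedRees : Subalgebra A A[T;T⁻¹] where
  carrier := {p | ∀ m : ℤ, F.CoeffMem m (p.coeff m)}
  mul_mem' {p q} hp hq := by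
    intro m
    rw [AddMonoidAlgebra.coeff_mul_apply_left, Finsupp.sum]
    refine Finset.sum_induction _ (fun a => F.CoeffMem m a) (fun a b ha hb => ha.add hb)
      (coeffMem_zero m) ?_
    intro h _
    have hmul := (hp h).mul (hq (-h + m))
    rwa [add_neg_cancel_left] at hmul
  add_mem' {p q} hp hq := fun m => by
    rw [AddMonoidAlgebra.coeff_add, Finsupp.add_apply]
    exact (hp m).add (hq m)
  algebraMap_mem' a := by
    intro m
    rw [← C_eq_algebraMap, C_apply]
    split_ifs with h
    · subst h
      intro n hn
      obtain rfl : n = 0 := by exact_mod_cast hn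
      rw [F.ideal_zero]
      trivial
    · exact coeffMem_zero m

/-- **Membership in the extended Rees algebra**: `p ∈ R[t⁻¹] ↔ coeffₙ p ∈ Jₙ` for all `n ≥ 0`.
[cite: Wlodarczyk2022, Def. 5.1.1] -/
theorem mem_extendedRees_iff {p : A[T;T⁻¹]} :
    p ∈ F.extendedRees ↔ ∀ n : ℕ, p.coeff n ∈ F.ideal n := by
  constructor
  · intro h n
    exact h n n rfl
  · intro h m n hn
    subst hn
    exact h n

/-- `t⁻¹ ∈ R[t⁻¹]`. [folklore] -/
theorem T_neg_one_mem_extendedRees : (T (-1) : A[T;T⁻¹]) ∈ F.extendedRees := by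
  rw [mem_extendedRees_iff]
  intro n
  rw [T_apply, if_neg (by omega)]
  exact Ideal.zero_mem _

/-- `a tⁿ ∈ R[t⁻¹] ↔ a ∈ Jₙ` (`n ≥ 0`). [folklore] -/
theorem C_mul_T_mem_extendedRees_iff {a : A} {n : ℕ} :
    C a * T (n : ℤ) ∈ F.extendedRees ↔ a ∈ F.ideal n := by
  rw [mem_extendedRees_iff]
  constructor
  · intro h
    have hn := h n
    rwa [← single_eq_C_mul_T, AddMonoidAlgebra.coeff_single, Finsupp.single_eq_same] at hn
  · intro ha k
    rw [← single_eq_C_mul_T, AddMonoidAlgebra.coeff_single, Finsupp.single_apply]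
    split_ifs with h
    · rwa [show k = n by exact_mod_cast h.symm]
    · exact Ideal.zero_mem _

end IdealFiltration

/-! ## The weighted filtration of a weighted centre -/

section weighted

variable {ι : Type v} (u : ι → A) (w : ι → ℕ)

/-- The monomials `u^α = ∏ uᵢ^{αᵢ}` of weight `Σ αᵢ wᵢ ≥ n` — generators of `𝒥ₙ`. [folklore] -/
def weightedMonomials (n : ℕ) : Set A :=
  {m | ∃ α : ι →₀ ℕ, n ≤ Finsupp.weight w α ∧ α.prod (fun i e => u i ^ e) = m}

/-- `u^α u^β = u^{α+β}`. [folklore] -/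
theorem prod_pow_add (α β : ι →₀ ℕ) :
    (α + β).prod (fun i e => u i ^ e) = α.prod (fun i e => u i ^ e) * β.prod (fun i e => u i ^ e) :=
  Finsupp.prod_add_index' (fun _ => pow_zero _) (fun _ _ _ => pow_add _ _ _)

/-- **The weighted filtration `𝒥ₙ = (u^α : Σ αᵢ wᵢ ≥ n)` of the weighted centre
`𝒥 = (u₁^{1/w₁}, …, u_k^{1/w_k})`** (Włodarczyk, Lemma 2.1.9: "`(𝒥^a)_X = I_{ν,a} =
(u^α | Σ αᵢ wᵢ ≥ a)`", the valuation ideals of the monomial valuation `ν(uᵢ) = wᵢ`; Lemma 2.1.8: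
`𝒜_𝒥 = ⊕_{a ≥ 0} I_{ν,a} t^a`). Defined for any family `u` and weights `w` in any commutative
ring. [cite: Wlodarczyk2022, Lemma 2.1.9] -/
def weightedFiltration : IdealFiltration A where
  ideal n := Ideal.span (weightedMonomials u w n)
  ideal_zero := by
    rw [Ideal.eq_top_iff_one]
    exact Ideal.subset_span ⟨0, by simp, by simp⟩
  antitone m n hmn := by
    refine Ideal.span_mono ?_
    rintro _ ⟨α, hα, rfl⟩
    exact ⟨α, hmn.trans hα, rfl⟩
  mul_le m n := by
    rw [Ideal.span_mul_span']
    refine Ideal.span_mono ?_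
    rintro _ ⟨a, ⟨α, hα, rfl⟩, b, ⟨β, hβ, rfl⟩, rfl⟩
    refine ⟨α + β, ?_, prod_pow_add u α β⟩
    rw [map_add]
    exact Nat.add_le_add hα hβ

/-- Unfolding the pieces of the weighted filtration. [folklore] -/
theorem weightedFiltration_ideal (n : ℕ) :
    (weightedFiltration u w).ideal n = Ideal.span (weightedMonomials u w n) := rfl

/-- `uᵢ ∈ 𝒥_{wᵢ}`. [folklore] -/
theorem mem_weightedFiltration_ideal (i : ι) : u i ∈ (weightedFiltration u w).ideal (w i) :=
  Ideal.subset_span ⟨Finsupp.single i 1, by simp [Finsupp.weight_single],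
    by rw [Finsupp.prod_single_index (h := fun i e => u i ^ e) (pow_zero _), pow_one]⟩

/-- In `A[t, t⁻¹]`: `∏ (uᵢ t^{wᵢ})^{αᵢ} = u^α t^{Σ αᵢ wᵢ}`. [folklore] -/
theorem coe_prod_u'_pow (α : ι →₀ ℕ) :
    ((α.prod fun i e => cobordantAlgebra.u' u w i ^ e : cobordantAlgebra u w) : A[T;T⁻¹]) =
      C (α.prod fun i e => u i ^ e) * T (Finsupp.weight w α : ℕ) := by
  induction α using Finsupp.induction with
  | zero =>
    simp only [Finsupp.prod_zero_index, OneMemClass.coe_one, map_one, map_zero, Nat.cast_zero, T_zero,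
      mul_one]
  | single_add a b f ha hb ih =>
    have e1 : ((Finsupp.single a b + f).prod fun i e => cobordantAlgebra.u' u w i ^ e) =
        cobordantAlgebra.u' u w a ^ b * f.prod fun i e => cobordantAlgebra.u' u w i ^ e := by
      rw [Finsupp.prod_add_index' (h := fun i e => cobordantAlgebra.u' u w i ^ e)
        (fun _ => pow_zero _) (fun _ _ _ => pow_add _ _ _),
        Finsupp.prod_single_index (h := fun i e => cobordantAlgebra.u' u w i ^ e) (pow_zero _)]
    have e2 : ((Finsupp.single a b + f).prod fun i e => u i ^ e) =
        u a ^ b * f.prod fun i e => u i ^ e := by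
      rw [Finsupp.prod_add_index' (h := fun i e => u i ^ e)
        (fun _ => pow_zero _) (fun _ _ _ => pow_add _ _ _),
        Finsupp.prod_single_index (h := fun i e => u i ^ e) (pow_zero _)]
    rw [e1, e2, MulMemClass.coe_mul, ih, SubmonoidClass.coe_pow, cobordantAlgebra.coe_u', map_add,
      Finsupp.weight_single, smul_eq_mul, Nat.cast_add, T_add, map_mul, map_pow, mul_pow, T_pow,
      Nat.cast_mul]
    ring

/-- **`A[t⁻¹, u₁ t^{w₁}, …, u_k t^{w_k}] = ⊕ₙ 𝒥ₙ tⁿ`**: the algebra of the full cobordant blow-up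
(Włodarczyk, Def. 2.3.5) is the extended Rees algebra of the weighted filtration
`𝒥ₙ = (u^α : Σ αᵢ wᵢ ≥ n)` (ibid. Lemma 2.1.8: `𝒜_𝒥 = 𝒪_X[u₁ t^{w₁}, …, u_k t^{w_k}] = ⊕ I_{ν,a} t^a`
and §2.2.7: `𝒜_𝒥^ext = 𝒪_X[t⁻¹, u₁ t^{w₁}, …, u_k t^{w_k}]`; the source states Lemma 2.1.8 for
`X` regular with the integral closure on the generator side — for the algebra generated by the
`uᵢ t^{wᵢ}` and the span of the monomials `u^α` the identity below holds over any ring).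
[cite: Wlodarczyk2022, Lemma 2.1.8] -/
theorem cobordantAlgebra_eq_extendedRees :
    cobordantAlgebra u w = (weightedFiltration u w).extendedRees := by
  apply le_antisymm
  · refine Algebra.adjoin_le ?_
    rintro _ (rfl | ⟨i, rfl⟩)
    · exact (weightedFiltration u w).T_neg_one_mem_extendedRees
    · exact ((weightedFiltration u w).C_mul_T_mem_extendedRees_iff).mpr
        (mem_weightedFiltration_ideal u w i)
  · intro p hp
    rw [← AddMonoidAlgebra.sum_coeff_single p, Finsupp.sum]
    refine Subalgebra.sum_mem _ fun m _ => ?_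
    rw [single_eq_C_mul_T]
    rcases lt_or_ge m 0 with hm | hm
    · obtain ⟨k, hk⟩ := Int.exists_eq_neg_ofNat hm.le
      rw [hk]
      exact cobordantAlgebra.C_mul_T_neg_natCast_mem u w _ k
    · obtain ⟨n, rfl⟩ := Int.eq_ofNat_of_zero_le hm
      have hn : p.coeff (n : ℤ) ∈ Ideal.span (weightedMonomials u w n) :=
        ((weightedFiltration u w).mem_extendedRees_iff.mp hp) n
      -- every `a ∈ 𝒥ₙ` gives `a tⁿ ∈ A[t⁻¹, uᵢ t^{wᵢ}]`
      refine Submodule.span_induction (p := fun a _ => C a * T (n : ℤ) ∈ cobordantAlgebra u w)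
        ?_ ?_ ?_ ?_ hn
      · rintro _ ⟨α, hα, rfl⟩
        have e : C (α.prod fun i e => u i ^ e) * T (n : ℤ) =
            ((α.prod fun i e => cobordantAlgebra.u' u w i ^ e : cobordantAlgebra u w) : A[T;T⁻¹]) *
              T (-((Finsupp.weight w α - n : ℕ) : ℤ)) := by
          rw [coe_prod_u'_pow, mul_assoc, ← T_add]
          congr 2
          push_cast [hα]
          ring
        rw [e]
        exact mul_mem (SetLike.coe_mem _) (cobordantAlgebra.T_neg_natCast_mem u w _)
      · rw [map_zero, zero_mul]
        exact Subalgebra.zero_mem _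
      · intro a b _ _ ha hb
        rw [map_add, add_mul]
        exact Subalgebra.add_mem _ ha hb
      · intro r a _ ha
        rw [smul_eq_mul, map_mul, mul_assoc]
        exact Subalgebra.mul_mem _ (by rw [C_eq_algebraMap]; exact Subalgebra.algebraMap_mem _ r) ha

end weighted

/-! ## Extended Rees algebras localize

Quasi-coherence of `U ↦ ⊕ₙ 𝒥ₙ(U) tⁿ`: if `A → A'` is the localization at `f` and the filtration
`F'` of `A'` is the extension of the filtration `F` of `A` (`𝒥ₙ' = 𝒥ₙ A'`, as for the sections of
an ideal sheaf over `D(f) ⊆ U`), then `R'[t⁻¹]` is the localization of `R[t⁻¹]` at `f`. This is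
what glues the extended Rees algebras over the affine opens of a scheme into the relative
spectrum `Spec_Y ⊕ₙ 𝒥ₙ tⁿ` (Włodarczyk, App. Def. 5.1.1). -/

namespace IdealFiltration

section Localization

variable {A' : Type v} [CommRing A'] [Algebra A A']
variable (F : IdealFiltration A) (F' : IdealFiltration A')

/-- Base change of Laurent polynomials `A[t, t⁻¹] → A'[t, t⁻¹]` maps `R[t⁻¹]` into `R'[t⁻¹]` as
soon as `𝒥ₙ A' ⊆ 𝒥ₙ'`. [folklore] -/
theorem mapRingHom_mem_extendedRees (hle : ∀ n, (F.ideal n).map (algebraMap A A') ≤ F'.ideal n)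
    {p : A[T;T⁻¹]} (hp : p ∈ F.extendedRees) :
    AddMonoidAlgebra.mapRingHom ℤ (algebraMap A A') p ∈ F'.extendedRees := by
  rw [mem_extendedRees_iff] at hp ⊢
  intro n
  rw [AddMonoidAlgebra.coeff_mapRingHom]
  exact hle n (Ideal.mem_map_of_mem _ (hp n))

/-- The map `R[t⁻¹] → R'[t⁻¹]` of extended Rees algebras induced by `A → A'` (restriction of the
base change of Laurent polynomials), when `𝒥ₙ A' ⊆ 𝒥ₙ'`. [folklore] -/
def extendedReesMap (hle : ∀ n, (F.ideal n).map (algebraMap A A') ≤ F'.ideal n) :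
    F.extendedRees →+* F'.extendedRees :=
  (AddMonoidAlgebra.mapRingHom ℤ (algebraMap A A')).restrict F.extendedRees F'.extendedRees
    fun _ hp => F.mapRingHom_mem_extendedRees F' hle hp

/-- `extendedReesMap` on underlying Laurent polynomials is the base change. [folklore] -/
@[simp] theorem coe_extendedReesMap (hle : ∀ n, (F.ideal n).map (algebraMap A A') ≤ F'.ideal n)
    (p : F.extendedRees) :
    ((F.extendedReesMap F' hle p : F'.extendedRees) : A'[T;T⁻¹]) =
      AddMonoidAlgebra.mapRingHom ℤ (algebraMap A A') p := rfl

/-- Multiplying by a constant on the right scales each coefficient. [folklore] -/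
theorem coeffMem_mul_C {m : ℤ} {p : A[T;T⁻¹]} (hp : F.CoeffMem m (p.coeff m)) (c : A) :
    F.CoeffMem m ((p * C c).coeff m) := by
  rw [← single_eq_C, AddMonoidAlgebra.coeff_mul_single_zero, mul_comm]
  exact hp.mul_left c

/-- `R[t⁻¹]` is stable under multiplication by constants `C c`. [folklore] -/
theorem mul_C_mem_extendedRees {p : A[T;T⁻¹]} (hp : p ∈ F.extendedRees) (c : A) :
    p * C c ∈ F.extendedRees :=
  fun m => F.coeffMem_mul_C (hp m) c

/-- A single term `a tᵐ` lies in `R[t⁻¹]` iff its coefficient satisfies the degree-`m` condition.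
[folklore] -/
theorem single_mem_extendedRees_iff {m : ℤ} {a : A} :
    AddMonoidAlgebra.single m a ∈ F.extendedRees ↔ F.CoeffMem m a := by
  constructor
  · intro h
    have := h m
    rwa [AddMonoidAlgebra.coeff_single, Finsupp.single_eq_same] at this
  · intro h m'
    rw [AddMonoidAlgebra.coeff_single, Finsupp.single_apply]
    split_ifs with hm
    · subst hm; exact h
    · exact coeffMem_zero m'

variable (f : A) [IsLocalization.Away f A']

/-- Over the localization `A' = A[1/f]`: every `a' ∈ A'` satisfying the degree-`m` condition for
the extended filtration `𝒥ₙ' = 𝒥ₙ A'` is `a / fᵏ` with `a` satisfying the degree-`m` condition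
for `𝒥`. [folklore] -/
theorem exists_of_coeffMem_map (heq : ∀ n, F'.ideal n = (F.ideal n).map (algebraMap A A'))
    {m : ℤ} {a' : A'} (ha' : F'.CoeffMem m a') :
    ∃ (k : ℕ) (a : A), F.CoeffMem m a ∧ a' * algebraMap A A' (f ^ k) = algebraMap A A' a := by
  rcases lt_or_ge m 0 with hm | hm
  · obtain ⟨⟨a, ⟨_, k, rfl⟩⟩, h⟩ := IsLocalization.surj (Submonoid.powers f) a'
    exact ⟨k, a, coeffMem_of_neg hm a, h⟩
  · obtain ⟨n, rfl⟩ := Int.eq_ofNat_of_zero_le hm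
    have hmem : a' ∈ (F.ideal n).map (algebraMap A A') := by
      rw [← heq n]
      exact coeffMem_natCast_iff.mp ha'
    obtain ⟨⟨⟨a, ha⟩, ⟨_, k, rfl⟩⟩, h⟩ :=
      (IsLocalization.mem_map_algebraMap_iff (Submonoid.powers f) A').mp hmem
    exact ⟨k, a, coeffMem_natCast_iff.mpr ha, h⟩

/-- **Extended Rees algebras localize.** If `A' = A[1/f]` and `𝒥ₙ' = 𝒥ₙ A'` for all `n`, then
`R'[t⁻¹] = ⊕ 𝒥ₙ' tⁿ` is the localization of `R[t⁻¹] = ⊕ 𝒥ₙ tⁿ` at `f` — the quasi-coherence of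
the extended Rees algebra of a Rees algebra of ideal sheaves, which makes
`B = Spec_X(R[t⁻¹])` (Włodarczyk, App. Def. 5.1.1) a scheme affine over `X` glued from the
`Spec ⊕ 𝒥ₙ(U) tⁿ`. [cite: Wlodarczyk2022, Def. 5.1.1] -/
theorem isLocalization_away_extendedRees
    (heq : ∀ n, F'.ideal n = (F.ideal n).map (algebraMap A A')) :
    letI := (F.extendedReesMap F' fun n => (heq n).ge).toAlgebra
    IsLocalization.Away (algebraMap A F.extendedRees f) F'.extendedRees := by
  letI := (F.extendedReesMap F' fun n => (heq n).ge).toAlgebra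
  have hle : ∀ n, (F.ideal n).map (algebraMap A A') ≤ F'.ideal n := fun n => (heq n).ge
  have halg : ∀ p : F.extendedRees, algebraMap F.extendedRees F'.extendedRees p =
      F.extendedReesMap F' hle p := fun _ => rfl
  set φ := algebraMap A A' with hφ
  have hmapC : ∀ x : A, AddMonoidAlgebra.mapRingHom ℤ φ (C x) = C (φ x) := fun x => by
    rw [← single_eq_C, AddMonoidAlgebra.mapRingHom_single, single_eq_C]
  -- the image of `(C f)ᵏ` is `C (fᵏ/1)`
  have hCf : ∀ k : ℕ, (((algebraMap F.extendedRees F'.extendedRees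
      (algebraMap A F.extendedRees f)) ^ k : F'.extendedRees) : A'[T;T⁻¹]) = C (φ (f ^ k)) := by
    intro k
    rw [SubmonoidClass.coe_pow, halg, coe_extendedReesMap, Subalgebra.coe_algebraMap,
      ← C_eq_algebraMap, hmapC, ← map_pow, ← map_pow]
  refine IsLocalization.Away.mk _ ?_ ?_ ?_
  · -- `f` becomes a unit
    have hu : IsUnit (algebraMap A' F'.extendedRees (φ f)) :=
      (IsLocalization.Away.algebraMap_isUnit f).map _
    convert hu using 1
    apply Subtype.ext
    have h1 := hCf 1
    rw [pow_one, pow_one] at h1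
    rw [h1, Subalgebra.coe_algebraMap, C_eq_algebraMap]
  · -- every element of `R'[t⁻¹]` is a fraction: decompose along the (finite) support, each
    -- single term `c tᵐ` lying in `R'[t⁻¹]`, and clear denominators coefficientwise
    intro z
    have key : ∀ s : Finset ℤ, (∀ m ∈ s, F'.CoeffMem m ((z : A'[T;T⁻¹]).coeff m)) →
        ∃ (N : ℕ) (a : A[T;T⁻¹]), a ∈ F.extendedRees ∧
          (∑ m ∈ s, AddMonoidAlgebra.single m ((z : A'[T;T⁻¹]).coeff m)) * C (φ (f ^ N)) =
            AddMonoidAlgebra.mapRingHom ℤ φ a := by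
      classical
      intro s
      induction s using Finset.induction_on with
      | empty =>
        intro _
        exact ⟨0, 0, Subalgebra.zero_mem _, by simp⟩
      | insert m s hm ih =>
        intro hs
        obtain ⟨N₁, a₁, ha₁, h₁⟩ := ih fun m' hm' => hs m' (Finset.mem_insert_of_mem hm')
        obtain ⟨k, a, ha, hka⟩ := F.exists_of_coeffMem_map F' f heq (hs m (Finset.mem_insert_self m s))
        refine ⟨N₁ + k, AddMonoidAlgebra.single m a * C (f ^ N₁) + a₁ * C (f ^ k),
          Subalgebra.add_mem _ (F.mul_C_mem_extendedRees ((F.single_mem_extendedRees_iff).mpr ha) _)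
            (F.mul_C_mem_extendedRees ha₁ _), ?_⟩
        have e1 : AddMonoidAlgebra.single m ((z : A'[T;T⁻¹]).coeff m) * C (φ (f ^ (N₁ + k))) =
            AddMonoidAlgebra.mapRingHom ℤ φ (AddMonoidAlgebra.single m a * C (f ^ N₁)) := by
          rw [map_mul, AddMonoidAlgebra.mapRingHom_single, hmapC, ← hka, ← single_eq_C,
            ← single_eq_C, AddMonoidAlgebra.single_mul_single, AddMonoidAlgebra.single_mul_single,
            pow_add, map_mul]
          congr 1
          ring
        have e2 : (∑ m ∈ s, AddMonoidAlgebra.single m ((z : A'[T;T⁻¹]).coeff m)) *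
            C (φ (f ^ (N₁ + k))) = AddMonoidAlgebra.mapRingHom ℤ φ (a₁ * C (f ^ k)) := by
          rw [pow_add, map_mul, map_mul, ← mul_assoc, h₁, map_mul, hmapC]
        rw [Finset.sum_insert hm, add_mul, e1, e2, ← map_add]
    obtain ⟨N, a, ha, h⟩ := key (z : A'[T;T⁻¹]).coeff.support fun m _ => z.2 m
    refine ⟨N, ⟨a, ha⟩, Subtype.ext ?_⟩
    rw [MulMemClass.coe_mul, hCf N, halg, coe_extendedReesMap, ← h]
    congr 1
    exact (AddMonoidAlgebra.sum_coeff_single (z : A'[T;T⁻¹])).symm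
  · -- the kernel is `f`-torsion
    intro p q hpq
    have hcoeff : ∀ m, φ ((p : A[T;T⁻¹]).coeff m) = φ ((q : A[T;T⁻¹]).coeff m) := by
      intro m
      have := congrArg (fun r : F'.extendedRees => (r : A'[T;T⁻¹]).coeff m) hpq
      simpa only [halg, coe_extendedReesMap, AddMonoidAlgebra.coeff_mapRingHom] using this
    -- a common power of `f` killing all the (finitely many) differences of coefficients
    have key : ∀ s : Finset ℤ, ∃ K : ℕ, ∀ m ∈ s,
        f ^ K * (p : A[T;T⁻¹]).coeff m = f ^ K * (q : A[T;T⁻¹]).coeff m := by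
      classical
      intro s
      induction s using Finset.induction_on with
      | empty => exact ⟨0, fun m hm => absurd hm (Finset.notMem_empty m)⟩
      | insert m s hm ih =>
        obtain ⟨K₁, hK₁⟩ := ih
        obtain ⟨⟨_, K₂, rfl⟩, hK₂⟩ := IsLocalization.exists_of_eq (M := Submonoid.powers f) (hcoeff m)
        change f ^ K₂ * (p : A[T;T⁻¹]).coeff m = f ^ K₂ * (q : A[T;T⁻¹]).coeff m at hK₂
        refine ⟨K₁ + K₂, fun m' hm' => ?_⟩
        rcases Finset.mem_insert.mp hm' with rfl | hm'
        · rw [pow_add, mul_assoc, mul_assoc, hK₂]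
        · rw [pow_add, mul_comm (f ^ K₁) (f ^ K₂), mul_assoc, mul_assoc, hK₁ m' hm']
    obtain ⟨K, hK⟩ := key ((p : A[T;T⁻¹]).coeff.support ∪ (q : A[T;T⁻¹]).coeff.support)
    refine ⟨K, Subtype.ext ?_⟩
    rw [MulMemClass.coe_mul, MulMemClass.coe_mul, SubmonoidClass.coe_pow, Subalgebra.coe_algebraMap,
      ← C_eq_algebraMap, ← map_pow]
    apply LaurentPolynomial.ext
    intro m
    rw [← single_eq_C, AddMonoidAlgebra.coeff_single_zero_mul, AddMonoidAlgebra.coeff_single_zero_mul]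
    by_cases hm : m ∈ (p : A[T;T⁻¹]).coeff.support ∪ (q : A[T;T⁻¹]).coeff.support
    · exact hK m hm
    · rw [Finset.mem_union, not_or, Finsupp.notMem_support_iff, Finsupp.notMem_support_iff] at hm
      rw [hm.1, hm.2]

end Localization

end IdealFiltration

end Literature.AlgebraicGeometry.Resolution
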